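import Literature.NumberTheory.GelbartRogawski1991.LocalDoubledUnitaryLagrangians
import HarnessLib

-- buildfix G11b-3 recipe (LEDGER B13-1/B13-3): elaborate sequentially so the trailing `attribute [implicit_reducible]`
-- block (reducibilityCoreExt is keyed to the async environment branch) is in force at `.olean` export.
set_option Elab.async false

/-!
# The elements `x(ν) = w · n(−ν)` of the doubled unitary group and their action on the big cell
# ([Kudla1994, §3]; [Weil1964, n° 32]; [HarrisKudlaSweet1996, §1 (1.11)])

Topic `NumberTheory/GelbartRogawski1991`; namespaces `Literature.NumberTheory.GelbartRogawski1991.AdaptedBlocks` (generic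
matrix algebra) and `…UnitaryDualPair.LocalSplitting` (the local doubled unitary group).  KERNEL only; no named fact,
no `sorry`.

For a `T`-skew matrix `ν` (`νᴴ T + T ν = 0`) the matrix with ADAPTED blocks `[[0, 1], [1, −ν]]` — the product of the
Weyl element `w` swapping `Δ, Δ⁻` and the unipotent `n(−ν)` of the opposite Siegel parabolic — lies in
`U(σ, T ⊕ −T)` (`cstar_xMat`), and left multiplication by it acts on the first adapted block column by
`C(x(ν) g) = A_g − ν C_g` (`blkC_xMat_mul`).  At a finite place this gives elements `xElem ν` of
`H(F_v) = U(𝕍 ⊕ −𝕍)(F_v)` (`matA_xElem`) with `C(xElem ν · t) = A_t − ν C_t` (`blkC_matA_xElem_mul`): the one-parameter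
families along which the big cell `Ω_H = {C invertible}` is shown to be left-generic ([Weil1964, n° 42]).

## References

* S. S. Kudla, Israel J. Math. 87 (1994) 361–401, §3 [Kudla1994].
* A. Weil, Acta Math. 111 (1964), n° 32, n° 42 [Weil1964].
* M. Harris, S. S. Kudla, W. J. Sweet, J. Amer. Math. Soc. 9 (1996), §1 (1.11) [HarrisKudlaSweet1996].
-/

set_option autoImplicit false

noncomputable section

open Matrix

namespace Literature.NumberTheory.GelbartRogawski1991.AdaptedBlocks

section Generic

variable {L : Type*} [CommRing L] {ι : Type*} [Fintype ι] [DecidableEq ι] [Invertible (2 : L)]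
  {σ : L →+* L} {T : Matrix ι ι L}

variable (L) in
/-- **`x(ν) = w · n(−ν)`**: the matrix whose adapted blocks are `[[0, 1], [1, −ν]]`. [cite: Kudla1994, §3; Weil1964, n° 32] -/
def xMat (ν : Matrix ι ι L) : Matrix (ι ⊕ ι) (ι ⊕ ι) L := cayR L ι * Matrix.fromBlocks 0 1 1 (-ν) * cayRinv L ι

variable (L) in
/-- the inverse `n(ν) · w` of `x(ν)`: adapted blocks `[[ν, 1], [1, 0]]`. [cite: Kudla1994, §3] -/
def xMatInv (ν : Matrix ι ι L) : Matrix (ι ⊕ ι) (ι ⊕ ι) L := cayR L ι * Matrix.fromBlocks ν 1 1 0 * cayRinv L ι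

/-- `x(ν) · x(ν)⁻¹ = 1`. [cite: Kudla1994, §3] -/
theorem xMat_mul_xMatInv (ν : Matrix ι ι L) : xMat L ν * xMatInv L ν = 1 := by
  rw [xMat, xMatInv]
  calc cayR L ι * Matrix.fromBlocks 0 1 1 (-ν) * cayRinv L ι * (cayR L ι * Matrix.fromBlocks ν 1 1 0 * cayRinv L ι)
      = cayR L ι * (Matrix.fromBlocks 0 1 1 (-ν) * ((cayRinv L ι * cayR L ι) * Matrix.fromBlocks ν 1 1 0)) * cayRinv L ι := by
        simp only [Matrix.mul_assoc]
    _ = 1 := by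
        rw [cayRinv_mul_cayR, Matrix.one_mul, Matrix.fromBlocks_multiply]
        simp [Matrix.fromBlocks_one, cayR_mul_cayRinv]

/-- `x(ν)⁻¹ · x(ν) = 1`. [cite: Kudla1994, §3] -/
theorem xMatInv_mul_xMat (ν : Matrix ι ι L) : xMatInv L ν * xMat L ν = 1 := by
  rw [xMat, xMatInv]
  calc cayR L ι * Matrix.fromBlocks ν 1 1 0 * cayRinv L ι * (cayR L ι * Matrix.fromBlocks 0 1 1 (-ν) * cayRinv L ι)
      = cayR L ι * (Matrix.fromBlocks ν 1 1 0 * ((cayRinv L ι * cayR L ι) * Matrix.fromBlocks 0 1 1 (-ν))) * cayRinv L ι := by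
        simp only [Matrix.mul_assoc]
    _ = 1 := by
        rw [cayRinv_mul_cayR, Matrix.one_mul, Matrix.fromBlocks_multiply]
        simp [Matrix.fromBlocks_one, cayR_mul_cayRinv]

/-- the adapted blocks of `x(ν)`: `A = 0`, `B = 1`, `C = 1`, `D = −ν`. [cite: Kudla1994, §3] -/
theorem blocks_xMat (ν : Matrix ι ι L) :
    blkA (xMat L ν) = 0 ∧ blkB (xMat L ν) = 1 ∧ blkC (xMat L ν) = 1 ∧ blkD (xMat L ν) = -ν := by
  have h := adapt_conj (Matrix.fromBlocks 0 1 1 (-ν) : Matrix (ι ⊕ ι) (ι ⊕ ι) L)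
  rw [adapt_eq] at h
  exact Matrix.fromBlocks_inj.1 h

/-- **`C(x(ν) · M) = A(M) − ν C(M)`**. [cite: Kudla1994, §3; Weil1964, n° 42] -/
theorem blkC_xMat_mul (ν : Matrix ι ι L) (M : Matrix (ι ⊕ ι) (ι ⊕ ι) L) :
    blkC (xMat L ν * M) = blkA M - ν * blkC M := by
  obtain ⟨-, -, hC, hD⟩ := blocks_xMat (L := L) ν
  rw [blkC_mul, hC, hD, Matrix.one_mul, Matrix.neg_mul, sub_eq_add_neg]

/-- **`x(ν) ∈ U(σ, T ⊕ −T)` for `T`-skew `ν`** (`νᴴ T + T ν = 0`): the adapted matrix `[[0,1],[1,−ν]]` preserves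
`antidiag(2T, 2T)`. [cite: Kudla1994, §3; HarrisKudlaSweet1996, §1 (1.11)] -/
theorem cstar_xMat {ν : Matrix ι ι L} (hν : (ν.map σ)ᵀ * T + T * ν = 0) :
    ((xMat L ν).map σ)ᵀ * Matrix.fromBlocks T 0 0 (-T) * xMat L ν = Matrix.fromBlocks T 0 0 (-T) := by
  apply cstar_mul_diag_mul_of_conj
  rw [Matrix.fromBlocks_map, Matrix.fromBlocks_transpose, Matrix.fromBlocks_multiply, Matrix.fromBlocks_multiply]
  have h1 : ((1 : Matrix ι ι L).map σ)ᵀ = 1 := by rw [Matrix.map_one σ (map_zero σ) (map_one σ), Matrix.transpose_one]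
  have h0 : ((0 : Matrix ι ι L).map σ)ᵀ = 0 := by rw [Matrix.map_zero σ (map_zero σ), Matrix.transpose_zero]
  have hn : ((-ν).map σ)ᵀ = -(ν.map σ)ᵀ := by rw [Matrix.map_neg _ (map_neg σ), Matrix.transpose_neg]
  have key : (ν.map σ)ᵀ * ((2 : L) • T) + (2 : L) • T * ν = 0 := by
    rw [Matrix.mul_smul, Matrix.smul_mul, ← smul_add, hν, smul_zero]
  rw [h1, h0, hn]
  simp only [Matrix.zero_mul, Matrix.mul_zero, Matrix.one_mul, Matrix.mul_one, zero_add, add_zero, Matrix.neg_mul,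
    Matrix.mul_neg, neg_zero]
  congr 1
  rw [← neg_add, key, neg_zero]

end Generic

end Literature.NumberTheory.GelbartRogawski1991.AdaptedBlocks

open NumberField IsDedekindDomain
open Literature.NumberTheory.Automorphic Literature.NumberTheory.Automorphic.UnitaryGroup
open Literature.NumberTheory.GelbartRogawski1991.AdaptedBlocks

namespace Literature.NumberTheory.GelbartRogawski1991.UnitaryDualPair.LocalSplitting

variable (F : Type) [Field F] [NumberField F] (E : Type) [Field E] [NumberField E] [Algebra F E]
  (c : E ≃ₐ[F] E) (v : HeightOneSpectrum (𝓞 F)) (n : ℕ) {T₀ : Matrix (Fin n) (Fin n) F}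
  {JD : Matrix (Fin (n + n)) (Fin (n + n)) E} (hJD : JD = (gramD F n T₀).map (algebraMap F E))

omit [NumberField F] in
/-- re-enumeration is multiplicative: `reindex e e (M N) = reindex e e M * reindex e e N`. [cite: Kudla1994, §3] -/
private theorem reindex_mul' (M N : Matrix (Fin n ⊕ Fin n) (Fin n ⊕ Fin n) (LocalRing E v)) :
    Matrix.reindex (e₂ n) (e₂ n) (M * N) = Matrix.reindex (e₂ n) (e₂ n) M * Matrix.reindex (e₂ n) (e₂ n) N := by
  rw [Matrix.reindex_apply, Matrix.reindex_apply, Matrix.reindex_apply, Matrix.submatrix_mul_equiv]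

include hJD in
/-- the re-enumerated `x(ν)` lies in the local unitary group `U(J^𝔻)(F_v)` (matrix form). [cite: Kudla1994, §3] -/
theorem reindex_xMat_mem {ν : Matrix (Fin n) (Fin n) (LocalRing E v)}
    (hν : (ν.map (conjLocal E c v))ᵀ * gramS F E v n T₀ + gramS F E v n T₀ * ν = 0)
    (hinv : Matrix.reindex (e₂ n) (e₂ n) (xMat (LocalRing E v) ν) * Matrix.reindex (e₂ n) (e₂ n) (xMatInv (LocalRing E v) ν) = 1)
    (hinv' : Matrix.reindex (e₂ n) (e₂ n) (xMatInv (LocalRing E v) ν) * Matrix.reindex (e₂ n) (e₂ n) (xMat (LocalRing E v) ν) = 1) :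
    (⟨Matrix.reindex (e₂ n) (e₂ n) (xMat (LocalRing E v) ν), Matrix.reindex (e₂ n) (e₂ n) (xMatInv (LocalRing E v) ν),
      hinv, hinv'⟩ : GL (Fin (n + n)) (LocalRing E v)) ∈ UnitaryGroup.local E c (n + n) JD v := by
  rw [UnitaryGroup.local, mem_unitaryGroupOfForm_iff, localFormD_eq F E v n hJD]
  change ((Matrix.reindex (e₂ n) (e₂ n) (xMat (LocalRing E v) ν)).map (conjLocal E c v))ᵀ *
      Matrix.reindex (e₂ n) (e₂ n) _ * Matrix.reindex (e₂ n) (e₂ n) (xMat (LocalRing E v) ν) = _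
  have ht : ((Matrix.reindex (e₂ n) (e₂ n) (xMat (LocalRing E v) ν)).map (conjLocal E c v))ᵀ =
      Matrix.reindex (e₂ n) (e₂ n) (((xMat (LocalRing E v) ν).map (conjLocal E c v))ᵀ) := by
    rw [Matrix.reindex_apply, Matrix.reindex_apply, ← Matrix.submatrix_map, Matrix.transpose_submatrix]
  rw [ht, ← reindex_mul', ← reindex_mul', cstar_xMat hν]

include hJD in
/-- **the element `x(ν) ∈ H(F_v)`** for a `T₀`-skew `ν` over `E ⊗ F_v`. [cite: Kudla1994, §3; Weil1964, n° 32] -/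
def xElem (ν : Matrix (Fin n) (Fin n) (LocalRing E v))
    (hν : (ν.map (conjLocal E c v))ᵀ * gramS F E v n T₀ + gramS F E v n T₀ * ν = 0) :
    UnitaryGroup.localPi E c (n + n) JD v :=
  (localPiEquiv E c (n + n) JD v).symm
    ⟨⟨Matrix.reindex (e₂ n) (e₂ n) (xMat (LocalRing E v) ν), Matrix.reindex (e₂ n) (e₂ n) (xMatInv (LocalRing E v) ν),
      by rw [← reindex_mul', xMat_mul_xMatInv]; simp, by rw [← reindex_mul', xMatInv_mul_xMat]; simp⟩,
      reindex_xMat_mem F E c v n hJD hν _ _⟩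

include hJD in
/-- **`matA (x(ν)) = xMat ν`**. [cite: Kudla1994, §3] -/
theorem matA_xElem (ν : Matrix (Fin n) (Fin n) (LocalRing E v))
    (hν : (ν.map (conjLocal E c v))ᵀ * gramS F E v n T₀ + gramS F E v n T₀ * ν = 0) :
    matA F E c v n (xElem F E c v n hJD ν hν) = xMat (LocalRing E v) ν := by
  rw [matA, matS, xElem, (localPiEquiv E c (n + n) JD v).apply_symm_apply]
  change Matrix.reindex (e₂ n).symm (e₂ n).symm (Matrix.reindex (e₂ n) (e₂ n) (xMat (LocalRing E v) ν)) = _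
  rw [Matrix.reindex_apply, Matrix.reindex_apply, Matrix.submatrix_submatrix, Equiv.symm_symm, Equiv.symm_comp_self,
    Matrix.submatrix_id_id]

include hJD in
/-- **`C(x(ν) · t) = A_t − ν C_t`** for `t ∈ H(F_v)`. [cite: Kudla1994, §3; Weil1964, n° 42] -/
theorem blkC_matA_xElem_mul (ν : Matrix (Fin n) (Fin n) (LocalRing E v))
    (hν : (ν.map (conjLocal E c v))ᵀ * gramS F E v n T₀ + gramS F E v n T₀ * ν = 0)
    (t : UnitaryGroup.localPi E c (n + n) JD v) :
    blkC (matA F E c v n (xElem F E c v n hJD ν hν * t)) = blkA (matA F E c v n t) - ν * blkC (matA F E c v n t) := by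
  rw [← matA_mul, matA_xElem, blkC_xMat_mul]

/-! ### Build-lane note (ops-buildfix G11b-3 recipe, LEDGER B13-1, 2026-08-21)
`lean -o` (the hub build lane, never `lean`/the gate check) runs Lean 4.32's library-suggestion indexers
(`Lean.LibrarySuggestions.SymbolFrequency` / `SineQuaNon`, from their `exportEntriesFn`) over the statement of
every local theorem that is not a denied premise; on this family's statements (very large dependent binder
telescopes through the theta-kernel / dual-pair data) that fold runs for tens of minutes to hours and the build
lane kills the job (incident G11b-3, run/shared/lean/ops/buildfix/G11b-3-DOSSIER.md). `isDeniedPremise` skips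
`[implicit_reducible]` constants before any fold, and a reducibility status on a *theorem* is inert (Meta never
unfolds `thmInfo`; the kernel ignores the attribute), so the public theorems of this file are tagged
`[implicit_reducible]` purely to keep them out of that index. Only other effect: they are not offered by
`+suggestions` premise selectors. No statement or proof is changed; superseded if the operator lands a
deny-list form (`HarnessLib.PremiseIndex`). -/
set_option allowUnsafeReducibility true in
attribute [implicit_reducible]
  _root_.Literature.NumberTheory.GelbartRogawski1991.AdaptedBlocks.xMat_mul_xMatInv
  _root_.Literature.NumberTheory.GelbartRogawski1991.AdaptedBlocks.xMatInv_mul_xMat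
  _root_.Literature.NumberTheory.GelbartRogawski1991.AdaptedBlocks.blocks_xMat
  _root_.Literature.NumberTheory.GelbartRogawski1991.AdaptedBlocks.blkC_xMat_mul
  _root_.Literature.NumberTheory.GelbartRogawski1991.AdaptedBlocks.cstar_xMat reindex_xMat_mem
  matA_xElem blkC_matA_xElem_mul

end Literature.NumberTheory.GelbartRogawski1991.UnitaryDualPair.LocalSplitting

end
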